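import Literature.Geometry.Symplectic.OrbitPeriodLocallyConstant
import Literature.Geometry.Manifold.CircleActionOrbitAverage
import HarnessLib

/-!
# Normalising a primitive of `ω` along a free Hamiltonian circle action: `(θ - dh)(X) = κ - H`

Topic `Literature/Geometry/Symplectic`; proofs file (layer "fibrewise normalisation", free part)
of the fact seat of `Literature.Geometry.Symplectic.mclean_divisorComplement_convex_four`
(M. McLean, *The growth rate of symplectic homology and affine varieties*, GAFA 22 (2012),
Lemma 5.17).  McLean (pp. 36–37) corrects a primitive `θ` of the symplectic form on the
punctured tube of the divisor by an exact form `df''` so that `θ + df''` restricted to the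
normal circles is `(r²/2 + κ) dϑ`, `κ` the wrapping number.  In the language of the tree's free
circle actions (`[MulAction Circle N]`, fundamental vector field `circleFundVec = X`), with the
action the Hamiltonian flow of an invariant function `H` (`σ(X, ·) = dH`, `dθ = σ`; on the tube
`H = -r²/2`), this file proves:

* `contMDiff_apply_circleFundVec` — **`y ↦ θ_y(X_y)` is `C^∞`** for a smooth `1`-form `θ`
  (read in the flat slice models `sliceTrivR`);
* `exists_orbitwise_correction` — **there are a `C^∞` function `h` and a locally constant `κ`
  with `dh(X) = θ(X) + H - κ`**, i.e. `(θ - dh)(X) = κ - H` (`h` = the orbitwise mean-zero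
  primitive of `θ(X) - ⟨θ(X)⟩`, `Literature/Geometry/Manifold/CircleActionOrbitAverage.lean`;
  `⟨θ(X)⟩ = κ - H` by `isLocallyConstant_orbitPeriod_add`).

Everything is proved; no definitions, no named facts (D-0026).

## References

* M. McLean, *The growth rate of symplectic homology and affine varieties*, Geom. Funct. Anal. 22
  (2012), pp. 36–37 (proof of Lemma 5.17). [Mclean2012]
* D. McDuff, D. Salamon, *Introduction to Symplectic Topology*, 3rd ed. (2017), §5.5.
  [McDuffSalamon2017]
-/

noncomputable section

open scoped Manifold ContDiff Topology Real
open Set Function Filter MeasureTheory intervalIntegral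
open Literature.Geometry.Kaehler Literature.Geometry.Manifold

namespace Literature.Geometry.Symplectic

variable {m : ℕ} {N : Type*} [TopologicalSpace N] [ChartedSpace (EuclideanSpace ℝ (Fin m)) N]
  [MulAction Circle N] {F : Type*} [NormedAddCommGroup F] [NormedSpace ℝ F]
  [IsManifold (𝓡 m) ∞ N] [T2Space N] [FiniteDimensional ℝ F]

omit [TopologicalSpace N] [ChartedSpace (EuclideanSpace ℝ (Fin m)) N] [MulAction Circle N]
  [NormedAddCommGroup F] [NormedSpace ℝ F] [IsManifold (𝓡 m) ∞ N] [T2Space N]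
  [FiniteDimensional ℝ F] in
/-- `![a]` pushed forward entrywise (generic, so that it rewrites under the tangent-space
synonyms). [folklore] -/
private theorem map_vecOne {X Y : Type*} (f : X → Y) (a : X) :
    (fun i : Fin 1 ↦ f (![a] i)) = ![f a] := by
  funext i; fin_cases i; rfl

omit [IsManifold (𝓡 m) ∞ N] [T2Space N] [FiniteDimensional ℝ F] in
/-- In a slice model, `θ(X)` at `sliceTrivR x` is the `(0, 1)`-component of the pulled-back
form. [folklore] -/
theorem apply_circleFundVec_sliceTrivR {p : N} (d : CircleSliceData (EuclideanSpace ℝ (Fin m)) F p)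
    (θ1 : MForm (𝓡 m) N ℝ 1)
    (hθ : ContMDiff ((𝓡 1).prod (𝓡 m)) (𝓡 m) ∞ (fun x : Circle × N => x.1 • x.2))
    {x : F × ℝ} (hx : x ∈ sliceDomR d) :
    θ1 (sliceTrivR d x) ![circleFundVec (sliceTrivR d x)] =
      (θ1.pullback 𝓘(ℝ, F × ℝ) (sliceTrivR d)) x ![((0, 1) : F × ℝ)] := by
  rw [MForm.pullback_apply, map_vecOne, mfderiv_sliceTrivR_inr d hθ hx]

variable (F) in
/-- **`θ(X)` is smooth**: for a free smooth circle action and a smooth `1`-form `θ`, the function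
`y ↦ θ_y(X_y)`, `X` the fundamental vector field, is `C^∞` (in the slice model through `y` it
is the `(0,1)`-component of the smooth pulled-back form, composed with the smooth inverse
coordinates `(coord, angle)`). [folklore] -/
theorem contMDiff_apply_circleFundVec
    (hθ : ContMDiff ((𝓡 1).prod (𝓡 m)) (𝓡 m) ∞ (fun x : Circle × N => x.1 • x.2))
    (hfree : ∀ (a : Circle) (x : N), a • x = x → a = 1)
    (hF : Module.finrank ℝ F + 1 = m)
    {θ1 : MForm (𝓡 m) N ℝ 1} (hθ1 : IsSmoothForm θ1) :
    ContMDiff (𝓡 m) 𝓘(ℝ, ℝ) ∞ fun y : N ↦ θ1 y ![circleFundVec y] := by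
  intro p
  obtain ⟨d⟩ := nonempty_circleSliceData (F := F) hθ hfree hF p
  set β : F × ℝ → (F × ℝ) [⋀^Fin 1]→L[ℝ] ℝ := θ1.pullback 𝓘(ℝ, F × ℝ) (sliceTrivR d) with hβ
  -- the flat function `x ↦ β x (0,1)` is smooth on `dom × ℝ`
  have hβs : ContDiffOn ℝ ∞ β (sliceDomR d) := contDiffOn_pullback_sliceTrivR d hθ hθ1
  have hG : ContDiffOn ℝ ∞ (fun x : F × ℝ ↦ β x ![((0, 1) : F × ℝ)]) (sliceDomR d) := by
    have h1 : ContDiffOn ℝ ∞ (fun x : F × ℝ ↦ alt1ToCLM (β x) ((0, 1) : F × ℝ)) (sliceDomR d) :=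
      ((alt1ToCLM (E := F × ℝ)).contDiff.comp_contDiffOn hβs).clm_apply contDiffOn_const
    refine h1.congr fun x _ ↦ ?_
    rw [alt1ToCLM_apply]
  have hG' : ContMDiffOn 𝓘(ℝ, F × ℝ) 𝓘(ℝ, ℝ) ∞ (fun x : F × ℝ ↦ β x ![((0, 1) : F × ℝ)])
      (sliceDomR d) := contMDiffOn_iff_contDiffOn.2 hG
  -- the inverse coordinates `(coord, angle)` are smooth on the tube `d.T`
  have hca : ContMDiffOn (𝓡 m) 𝓘(ℝ, F × ℝ) ∞ (fun y : N ↦ (d.coord y, d.angle y)) d.T := by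
    have h := d.contMDiffOn_coord.prodMk d.contMDiffOn_angle
    rw [modelWithCornersSelf_prod, ← chartedSpaceSelf_prod]
    exact h
  have hcomp : ContMDiffOn (𝓡 m) 𝓘(ℝ, ℝ) ∞
      (fun y : N ↦ β (d.coord y, d.angle y) ![((0, 1) : F × ℝ)]) d.T :=
    hG'.comp hca fun y hy ↦ by
      simpa [sliceDomR] using d.coord_mem_dom hy
  -- and agree with `θ(X)` there
  have hev : ∀ y ∈ d.T, θ1 y ![circleFundVec y] = β (d.coord y, d.angle y) ![((0, 1) : F × ℝ)] := by
    intro y hy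
    have hx : ((d.coord y, d.angle y) : F × ℝ) ∈ sliceDomR d := by
      simpa [sliceDomR] using d.coord_mem_dom hy
    have h := apply_circleFundVec_sliceTrivR d θ1 hθ hx
    have hyT : sliceTrivR d (d.coord y, d.angle y) = y := d.exp_angle_smul_param_coord hy
    rw [hyT] at h
    exact h
  have hT : d.T ∈ 𝓝 p := d.hTo.mem_nhds d.hpT
  refine ((hcomp.contMDiffAt hT).congr_of_eventuallyEq ?_)
  filter_upwards [hT] with y hy
  exact hev y hy

variable (F) in
/-- **Orbitwise normalisation of a primitive** (McLean 2012, pp. 36–37, the correction `f''`;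
McDuff–Salamon 2017, §5.5): for a free smooth circle action which is the Hamiltonian flow of an
invariant `C^∞` function `H` (`σ(X, ·) = dH`) and a smooth `1`-form `θ` with `dθ = σ`, there are a
`C^∞` function `h` and a locally constant function `κ` on `N` with

  `dh(X) = θ(X) + H - κ`,  i.e.  `(θ - dh)(X) = κ - H`.

(`h` is the orbitwise mean-zero primitive of `θ(X) - ⟨θ(X)⟩`, and `⟨θ(X)⟩ = κ - H` because
`∮θ + 2πH` is locally constant.) [cite: Mclean2012, Lemma 5.17 (proof)] -/
theorem exists_orbitwise_correction
    (hθ : ContMDiff ((𝓡 1).prod (𝓡 m)) (𝓡 m) ∞ (fun x : Circle × N => x.1 • x.2))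
    (hfree : ∀ (a : Circle) (x : N), a • x = x → a = 1)
    (hF : Module.finrank ℝ F + 1 = m)
    {θ1 : MForm (𝓡 m) N ℝ 1} {σ2 : MForm (𝓡 m) N ℝ 2} (hθ1 : IsSmoothForm θ1)
    (hd : mextDeriv θ1 = σ2) {H : N → ℝ} (hH : ContMDiff (𝓡 m) 𝓘(ℝ, ℝ) ∞ H)
    (hinv : ∀ (a : Circle) (x : N), H (a • x) = H x)
    (hT4 : ∀ (x : N) (w : TangentSpace (𝓡 m) x),
      σ2 x ![circleFundVec x, w] = mfderiv (𝓡 m) 𝓘(ℝ, ℝ) H x w) :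
    ∃ (h κ : N → ℝ), ContMDiff (𝓡 m) 𝓘(ℝ, ℝ) ∞ h ∧ IsLocallyConstant κ ∧
      ∀ y : N, mfderiv (𝓡 m) 𝓘(ℝ, ℝ) h y (circleFundVec y) =
        θ1 y ![circleFundVec y] + H y - κ y := by
  set g : N → ℝ := fun y ↦ θ1 y ![circleFundVec y] with hg
  have hgs : ContMDiff (𝓡 m) 𝓘(ℝ, ℝ) ∞ g := contMDiff_apply_circleFundVec F hθ hfree hF hθ1
  -- the action in the `θ : Circle → N → N` convention of `CircleActionOrbitAverage.lean`
  have hθ' : ContMDiff ((𝓡 1).prod (𝓡 m)) (𝓡 m) ∞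
      (fun p : Circle × N ↦ (fun (a : Circle) (x : N) ↦ a • x) p.1 p.2) := hθ
  have hone : ∀ x : N, (fun (a : Circle) (x : N) ↦ a • x) 1 x = x := fun x ↦ one_smul _ _
  have hmul : ∀ (a b : Circle) (x : N),
      (fun (a : Circle) (x : N) ↦ a • x) (a * b) x =
        (fun (a : Circle) (x : N) ↦ a • x) a ((fun (a : Circle) (x : N) ↦ a • x) b x) :=
    fun a b x ↦ mul_smul a b x
  -- the orbitwise mean-zero primitive of `g - ⟨g⟩`
  set h : N → ℝ := fun y ↦ -((2 * π)⁻¹ * ∫ τ in (0 : ℝ)..2 * π,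
    ((∫ σ in (0 : ℝ)..τ, g (Circle.exp σ • y)) -
      τ * ((2 * π)⁻¹ * ∫ σ in (0 : ℝ)..2 * π, g (Circle.exp σ • y)))) with hh
  -- the locally constant `κ = (2π)⁻¹ ∮θ + H`
  set κ : N → ℝ := fun y ↦
    (2 * π)⁻¹ * ((∫ t in (0 : ℝ)..2 * π, g (Circle.exp t • y)) + 2 * π * H y) with hκ
  have hL : IsLocallyConstant fun y : N ↦
      (∫ t in (0 : ℝ)..2 * π, g (Circle.exp t • y)) + 2 * π * H y :=
    isLocallyConstant_orbitPeriod_add (F := F) hθ hfree hF hθ1 hd hH hinv hT4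
  refine ⟨h, κ, ?_, ?_, ?_⟩
  · exact contMDiff_orbitMeanZero (θ := fun (a : Circle) (x : N) ↦ a • x) hθ' hgs
  · exact hL.comp fun v ↦ (2 * π)⁻¹ * v
  · intro y
    have e1 := mfderiv_orbitMeanZero_fundamental (θ := fun (a : Circle) (x : N) ↦ a • x)
      hθ' hone hmul hgs y
    have e2 : mfderiv (𝓡 m) 𝓘(ℝ, ℝ) h y (circleFundVec y) =
        g y - (2 * π)⁻¹ * ∫ σ in (0 : ℝ)..2 * π, g (Circle.exp σ • y) := e1
    rw [e2]
    show g y - (2 * π)⁻¹ * (∫ σ in (0 : ℝ)..2 * π, g (Circle.exp σ • y)) =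
      g y + H y - (2 * π)⁻¹ * ((∫ t in (0 : ℝ)..2 * π, g (Circle.exp t • y)) + 2 * π * H y)
    have hπ : (2 * π)⁻¹ * (2 * π) = 1 := inv_mul_cancel₀ (by positivity)
    linear_combination (H y) * hπ

end Literature.Geometry.Symplectic
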